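import Mathlib
import Summits.ValiantsHypothesis.ValiantsHypothesis.Theorems.BinomialElusiveBinomialMapsElusivePolyWeightRelations

/-!
# ValiantsHypothesis / BinomialElusive — "zero or huge": nonzero short combinations of the exponents

Support file for crux `BinomialMapsElusive` (stmt-ValiantsHypothesis-7393), companion of
`BinomialElusiveBinomialMapsElusivePolyWeightRelations.lean`.

For the carry-free power sums `E(j) = Σ_{k ≤ h} (j M)^k`, `M = (2m+2)^{h+1}`, a NONZERO integer
combination `v = Σ_j w_j E(j+1)` whose support has `σ` indices and whose weight `W = Σ_j |w_j|` is at
most `(m+1)²` satisfies `|v| ≥ M^{h+1-σ} / 2` (`base_pow_le_two_mul_abs_relation`).  Reason: the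
moments `π_k = Σ_j w_j (j+1)^k` are the base-`M` digits of `v`; the top `σ` of them
(`k = h+1-σ, …, h`) cannot all vanish (a Vandermonde matrix with rows shifted by `x_j^{h+1-σ}`,
`top_moments_ne_zero`), and all digits below the top nonzero one are `< M/2` in absolute value, so
they cannot cancel it (`base_pow_le_two_mul_abs_digits`).  This is the quantitative form of
"a short relation is either exact or misses by at least `M^{h+1-σ}/2`" used by depth / window
arguments at the place over `0` (STRUCTURE-p2 §0, §2: e.g. an unbalanced closed walk of length `ℓ`
in the term multigraph forces a coordinate of depth `≥ N·M^{h+1-ℓ}/(2ℓ)`).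
-/

namespace Summit.ValiantsHypothesis.ValiantsHypothesis.Theorems.BinomialElusiveNoShortRelations

-- summit = sub-problem name (single-conjunct summit, D-0017 layout), so the namespace repeats it
set_option linter.dupNamespace false

open scoped BigOperators
open Finset

/-- **Top digit dominates.**  If the digits `d_k`, `k < K`, satisfy `1 + 2|d_k| ≤ M`, the digit
`d_K` is nonzero and all digits `d_k`, `K < k < n`, vanish (`K < n`), then
`M^K ≤ 2 |Σ_{k<n} d_k M^k|`. -/
theorem base_pow_le_two_mul_abs_digits (M : ℤ) (hM : 0 < M) (n K : ℕ) (d : ℕ → ℤ) (hKn : K < n)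
    (hsmall : ∀ k < K, 1 + 2 * |d k| ≤ M) (hK : d K ≠ 0) (hzero : ∀ k, K < k → k < n → d k = 0) :
    M ^ K ≤ 2 * |∑ k ∈ Finset.range n, d k * M ^ k| := by
  -- the tail below `K` is at most `(M^K - 1)/2`
  have htail : ∀ L ≤ K, 2 * ∑ k ∈ Finset.range L, |d k| * M ^ k ≤ M ^ L - 1 := by
    intro L
    induction L with
    | zero => intro _; simp
    | succ L ih =>
      intro hL
      rw [Finset.sum_range_succ, mul_add, pow_succ]
      have h1 := ih (Nat.le_of_succ_le hL)
      have h2 := hsmall L (Nat.lt_of_succ_le hL)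
      have hML : 0 ≤ M ^ L := pow_nonneg hM.le L
      nlinarith [abs_nonneg (d L)]
  -- only the digits `k ≤ K` contribute
  have hsplit : ∑ k ∈ Finset.range n, d k * M ^ k
      = d K * M ^ K + ∑ k ∈ Finset.range K, d k * M ^ k := by
    have hsub : Finset.range (K + 1) ⊆ Finset.range n := Finset.range_subset_range.mpr hKn
    rw [← Finset.sum_subset hsub (fun k hk hk' => by
      have hkK : K < k := by
        simp only [Finset.mem_range] at hk hk'; omega
      rw [hzero k hkK (Finset.mem_range.mp hk), zero_mul]), Finset.sum_range_succ, add_comm]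
  rw [hsplit]
  have habs : |∑ k ∈ Finset.range K, d k * M ^ k| ≤ ∑ k ∈ Finset.range K, |d k| * M ^ k := by
    refine (Finset.abs_sum_le_sum_abs _ _).trans (Finset.sum_le_sum fun k _ => ?_)
    rw [abs_mul, abs_of_nonneg (pow_nonneg hM.le k)]
  have hdK : 1 ≤ |d K| := Int.one_le_abs hK
  have hMK : 0 ≤ M ^ K := pow_nonneg hM.le K
  have ht := htail K le_rfl
  -- |d_K M^K + tail| ≥ |d_K| M^K - |tail| ≥ M^K - (M^K - 1)/2
  have h3 : |d K| * M ^ K - |∑ k ∈ Finset.range K, d k * M ^ k|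
      ≤ |d K * M ^ K + ∑ k ∈ Finset.range K, d k * M ^ k| := by
    have := abs_sub_abs_le_abs_sub (d K * M ^ K) (-(∑ k ∈ Finset.range K, d k * M ^ k))
    rw [abs_neg, sub_neg_eq_add, abs_mul, abs_of_nonneg hMK] at this
    exact this
  nlinarith

/-- **The top `σ` moments of a nonzero vector do not all vanish.**  If `w : Fin (2m) → ℤ` is
nonzero with `σ` nonzero entries and `σ + k₀ ≤ h + 1`, then some moment `Σ_j w_j (j+1)^k`,
`k₀ ≤ k ≤ h`, is nonzero (shifted Vandermonde on the support). -/
theorem top_moments_ne_zero (m h k₀ : ℕ) (w : Fin (2 * m) → ℤ) (hw : w ≠ 0)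
    (hσ : (Finset.univ.filter (fun j => w j ≠ 0)).card + k₀ ≤ h + 1) :
    ∃ k, k₀ ≤ k ∧ k ≤ h ∧ ∑ j : Fin (2 * m), w j * (((j : ℕ) : ℤ) + 1) ^ k ≠ 0 := by
  by_contra hcon
  push Not at hcon
  apply hw
  set s : Finset (Fin (2 * m)) := Finset.univ.filter (fun j => w j ≠ 0) with hs
  have hmem : ∀ j, j ∈ s ↔ w j ≠ 0 := fun j => by simp [hs]
  obtain ⟨e⟩ : Nonempty (Fin s.card ≃ {x // x ∈ s}) := ⟨s.equivFin.symm⟩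
  have hf : Function.Injective (fun i : Fin s.card => (((e i : Fin (2 * m)) : ℕ) : ℤ) + 1) := by
    intro a b hab
    have hab' : (((e a : Fin (2 * m)) : ℕ) : ℤ) + 1 = (((e b : Fin (2 * m)) : ℕ) : ℤ) + 1 := hab
    exact e.injective (Subtype.ext (Fin.ext (by exact_mod_cast (add_right_cancel hab'))))
  -- Vandermonde for the scaled vector `v_i = w(e i) (x_i)^{k₀}`
  have hv : (fun i : Fin s.card => w (e i) * ((((e i : Fin (2 * m)) : ℕ) : ℤ) + 1) ^ k₀) = 0 := by
    refine Matrix.eq_zero_of_forall_pow_sum_mul_pow_eq_zero hf fun i => ?_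
    show ∑ j : Fin s.card, (w (e j) * ((((e j : Fin (2 * m)) : ℕ) : ℤ) + 1) ^ k₀)
        * ((((e j : Fin (2 * m)) : ℕ) : ℤ) + 1) ^ (i : ℕ) = 0
    have h1 : ∑ j : Fin s.card, (w (e j) * ((((e j : Fin (2 * m)) : ℕ) : ℤ) + 1) ^ k₀)
          * ((((e j : Fin (2 * m)) : ℕ) : ℤ) + 1) ^ (i : ℕ)
        = ∑ x : {x // x ∈ s}, w x * ((((x : Fin (2 * m)) : ℕ) : ℤ) + 1) ^ (k₀ + i) :=
      Fintype.sum_equiv e _ _ fun j => by rw [pow_add, mul_assoc]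
    have h2 : ∑ x ∈ s, w x * (((x : ℕ) : ℤ) + 1) ^ (k₀ + i)
        = ∑ x, w x * (((x : ℕ) : ℤ) + 1) ^ (k₀ + i) := by
      refine Finset.sum_subset (Finset.subset_univ _) fun x _ hx => ?_
      have hx' : w x = 0 := by simpa [hmem] using hx
      simp [hx']
    rw [h1, Finset.sum_coe_sort s (fun x => w x * (((x : ℕ) : ℤ) + 1) ^ (k₀ + (i : ℕ))), h2]
    exact hcon (k₀ + i) (Nat.le_add_right _ _) (by have := i.isLt; omega)
  funext j₀
  rw [Pi.zero_apply]
  by_contra hj₀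
  have hval := congr_fun hv (e.symm ⟨j₀, (hmem j₀).mpr hj₀⟩)
  simp only [Equiv.apply_symm_apply, Pi.zero_apply, mul_eq_zero] at hval
  rcases hval with h | h
  · exact hj₀ h
  · have : (0 : ℤ) < ((j₀ : ℕ) : ℤ) + 1 := by positivity
    exact absurd (eq_zero_of_pow_eq_zero h) this.ne'

/-- **Zero or huge.**  Let `w : Fin (2m) → ℤ` be nonzero with `σ` nonzero entries, weight
`Σ_j |w_j| ≤ (m+1)²`, and `σ + k₀ ≤ h + 1`.  Then `M^{k₀} ≤ 2 |Σ_j w_j E(j+1)|`, where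
`E(j) = Σ_{k ≤ h} (j M)^k` and `M = (2m+2)^{h+1}`: a nonzero combination of support `σ` has absolute
value at least `M^{h+1-σ}/2`. -/
theorem base_pow_le_two_mul_abs_relation (m h k₀ : ℕ) (w : Fin (2 * m) → ℤ) (hw : w ≠ 0)
    (hW : ∑ j, |w j| ≤ ((m : ℤ) + 1) ^ 2)
    (hσ : (Finset.univ.filter (fun j => w j ≠ 0)).card + k₀ ≤ h + 1) :
    ((2 * (m : ℤ) + 2) ^ (h + 1)) ^ k₀ ≤
      2 * |∑ j, w j * ((∑ k ∈ Finset.range (h + 1),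
        (((j : ℕ) + 1) * (2 * m + 2) ^ (h + 1)) ^ k : ℕ) : ℤ)| := by
  set π : ℕ → ℤ := fun k => ∑ j : Fin (2 * m), w j * (((j : ℕ) : ℤ) + 1) ^ k with hπ
  -- §1: digit expansion of the value
  have hdigits : ∑ j, w j * ((∑ k ∈ Finset.range (h + 1),
        (((j : ℕ) + 1) * (2 * m + 2) ^ (h + 1)) ^ k : ℕ) : ℤ)
      = ∑ k ∈ Finset.range (h + 1), π k * ((2 * (m : ℤ) + 2) ^ (h + 1)) ^ k := by
    have key : ∀ j : Fin (2 * m), (w j : ℤ) * ((∑ k ∈ Finset.range (h + 1),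
        (((j : ℕ) + 1) * (2 * m + 2) ^ (h + 1)) ^ k : ℕ) : ℤ)
        = ∑ k ∈ Finset.range (h + 1),
            w j * (((j : ℕ) : ℤ) + 1) ^ k * ((2 * (m : ℤ) + 2) ^ (h + 1)) ^ k := by
      intro j
      push_cast
      rw [Finset.mul_sum]
      exact Finset.sum_congr rfl fun k _ => by rw [mul_pow, ← mul_assoc]
    rw [Finset.sum_congr rfl (fun j _ => key j), Finset.sum_comm]
    exact Finset.sum_congr rfl fun k _ => by rw [hπ, Finset.sum_mul]
  rw [hdigits]
  -- §2: the top nonzero digit `K ≥ k₀`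
  obtain ⟨k₁, hk₁, hk₁h, hk₁ne⟩ := top_moments_ne_zero m h k₀ w hw hσ
  set S : Finset ℕ := (Finset.range (h + 1)).filter (fun k => π k ≠ 0) with hS
  have hSne : S.Nonempty := ⟨k₁, by simp [hS, Finset.mem_range]; exact ⟨by omega, hk₁ne⟩⟩
  set K := S.max' hSne with hK
  have hKS : K ∈ S := Finset.max'_mem S hSne
  have hKh : K < h + 1 := by
    have := (Finset.mem_filter.mp hKS).1; simpa [Finset.mem_range] using this
  have hKne : π K ≠ 0 := (Finset.mem_filter.mp hKS).2
  have hk₁K : k₁ ≤ K := Finset.le_max' S k₁ (by simp [hS, Finset.mem_range]; exact ⟨by omega, hk₁ne⟩)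
  have hzero : ∀ k, K < k → k < h + 1 → π k = 0 := by
    intro k hKk hkh
    by_contra hne
    have : k ≤ K := Finset.le_max' S k (by simp [hS, Finset.mem_range]; exact ⟨by omega, hne⟩)
    omega
  -- §3: the lower digits are small: `1 + 2|π_k| ≤ M` for `k < K ≤ h`
  have hm : 1 ≤ m := by
    rcases Nat.eq_zero_or_pos m with rfl | hm
    · exact absurd (funext fun j => Fin.elim0 (j.cast (by norm_num))) hw
    · exact hm
  have hsmall : ∀ k < K, 1 + 2 * |π k| ≤ (2 * (m : ℤ) + 2) ^ (h + 1) := by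
    intro k hk
    have hkh : k ≤ h - 1 := by omega
    have hbound : |π k| ≤ ((m : ℤ) + 1) ^ 2 * (2 * (m : ℤ)) ^ (h - 1) := by
      calc |π k| ≤ ∑ j : Fin (2 * m), |w j * (((j : ℕ) : ℤ) + 1) ^ k| :=
            Finset.abs_sum_le_sum_abs _ _
        _ ≤ ∑ j : Fin (2 * m), |w j| * (2 * (m : ℤ)) ^ (h - 1) := by
            refine Finset.sum_le_sum fun j _ => ?_
            rw [abs_mul]
            refine mul_le_mul_of_nonneg_left ?_ (abs_nonneg _)
            have hj : (((j : ℕ) : ℤ) + 1) ≤ 2 * (m : ℤ) := by have := j.isLt; omega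
            have hj0 : (0 : ℤ) ≤ ((j : ℕ) : ℤ) + 1 := by positivity
            rw [abs_of_nonneg (pow_nonneg hj0 _)]
            calc (((j : ℕ) : ℤ) + 1) ^ k ≤ (2 * (m : ℤ)) ^ k := pow_le_pow_left₀ hj0 hj k
              _ ≤ (2 * (m : ℤ)) ^ (h - 1) := pow_le_pow_right₀ (by omega) hkh
        _ = (∑ j : Fin (2 * m), |w j|) * (2 * (m : ℤ)) ^ (h - 1) := (Finset.sum_mul _ _ _).symm
        _ ≤ ((m : ℤ) + 1) ^ 2 * (2 * (m : ℤ)) ^ (h - 1) :=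
            mul_le_mul_of_nonneg_right hW (by positivity)
    -- `1 + 2(m+1)²(2m)^{h-1} ≤ (2m+2)^{h+1} = 4(m+1)² (2m+2)^{h-1}`
    have hh : h = (h - 1) + 1 := by omega
    have hpow : (2 * (m : ℤ)) ^ (h - 1) ≤ (2 * (m : ℤ) + 2) ^ (h - 1) :=
      pow_le_pow_left₀ (by positivity) (by linarith) _
    have hone : (1 : ℤ) ≤ ((m : ℤ) + 1) ^ 2 * (2 * (m : ℤ) + 2) ^ (h - 1) := by
      have h1 : (1 : ℤ) ≤ ((m : ℤ) + 1) ^ 2 := one_le_pow₀ (by linarith)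
      have h2 : (1 : ℤ) ≤ (2 * (m : ℤ) + 2) ^ (h - 1) := one_le_pow₀ (by linarith)
      nlinarith
    have hsq : (0 : ℤ) ≤ ((m : ℤ) + 1) ^ 2 := by positivity
    calc 1 + 2 * |π k| ≤ 1 + 2 * (((m : ℤ) + 1) ^ 2 * (2 * (m : ℤ)) ^ (h - 1)) := by linarith
      _ ≤ 1 + 2 * (((m : ℤ) + 1) ^ 2 * (2 * (m : ℤ) + 2) ^ (h - 1)) := by
          nlinarith [mul_le_mul_of_nonneg_left hpow hsq]
      _ ≤ 4 * (((m : ℤ) + 1) ^ 2 * (2 * (m : ℤ) + 2) ^ (h - 1)) := by linarith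
      _ = (2 * (m : ℤ) + 2) ^ (h + 1) := by
          conv_rhs => rw [hh, pow_succ, pow_succ]
          ring
  -- §4: conclude
  calc ((2 * (m : ℤ) + 2) ^ (h + 1)) ^ k₀ ≤ ((2 * (m : ℤ) + 2) ^ (h + 1)) ^ K :=
        pow_le_pow_right₀ (by
          have : (1 : ℤ) ≤ 2 * (m : ℤ) + 2 := by omega
          exact one_le_pow₀ this) (hk₁.trans hk₁K)
    _ ≤ 2 * |∑ k ∈ Finset.range (h + 1), π k * ((2 * (m : ℤ) + 2) ^ (h + 1)) ^ k| :=
        base_pow_le_two_mul_abs_digits _ (by positivity) (h + 1) K π hKh hsmall hKne hzero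

end Summit.ValiantsHypothesis.ValiantsHypothesis.Theorems.BinomialElusiveNoShortRelations
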